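import Summits.CriticalPhenomena.PercolationContinuityZ3.Theorems.Transplant.SkelNegBParamsReachFC
import Summits.CriticalPhenomena.PercolationContinuityZ3.Theorems.Transplant.SkelNegBChoiceAllT
import Summits.CriticalPhenomena.PercolationContinuityZ3.Theorems.Transplant.SkelNegBParamsRootLam
import HarnessLib

/-!
# N1 params, chain of record `NegB`, part ReachT: THE (C) CORRIDOR's FRAME-CHANGE NUMBERS AT `b0T := r/4` AND p5-g9's FIVE PRIMITIVE FLOORS (2026-08-21T19:58:36Z)
# — `NegB.aWT/BxT/bLT` (part ReachFC's `aW/Bx/bL` with `b0T`), `ha_T/hBx_T/hb_T`, and the sizes **(P3) `aWT ≤ 24·n_L`**, **(P4) `U·(bLT + 1) ≤ 12·Δ`**,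
# **(P5) `r_i ≤ 4·b0T_i`**, `hsc_R` (commensurability `c_i′·A·40Δ = r_i·D`); (P1)/(P2) are part SlotsT's `nL_floorsT`/`corridor_floors_T` with `T := RA′`

Sizes: `aW = ⌈800(c₁n(b0₀+1) + c₀|v_L|(b0₁+1))/(c₀c₁)⌉ ≤ n(10 + 1) + |v_L|(10 + 1) + 1 ≤ 22n + 1` (`c_i = 800·Kq·s_i`, `b0T_i = 10·Kq·s_i`);
`Bx = ⌊Δ(b0₁+1)/(Kq s₁)⌋ + 1 ≤ 11Δ + 1`, `U(bL + 1) ≤ Bx + 2U ≤ 12Δ` (`2U + 1 ≤ Δ` from `Δ > n(ℓ−1)`, `U ≤ 11n`, `ℓ ≥ 24`).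

builds on p205010 (kernel theorem, internal audit signed; external expert review pending) — nothing in this file uses p205010; NOTHING is claimed about
the node `SamePDropOfSkeletonNeg₁` (OPEN).
Lane `prim-bschramm-*`, seat `prim-bschramm-stmt` (gen 14); helper file (`--supports stmt-CriticalPhenomena-4575 --as helper`); ledger HOME/prim-bschramm-stmt/NEG-PARAMS.md v0.13.
[cite: KozmaNitzan2024, §4 Lemma 12 (pp. 23–25)] [cite: MartineauTassion2017, §4.3 Lemma 4.2]
-/

noncomputable section

open scoped Classical

namespace Summit.CriticalPhenomena.PercolationContinuityZ3.Theorems.Transplant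

namespace PlanarSkeletonNeg

namespace NegB

open Literature.Probability.Percolation Literature.Probability.LatticeModels SimpleGraph
open SkelConc (Consts)
open Skelφ.StepI (DataN)
open TwoAxis.Para (modulus)
open Skelφ (shearUnit shearUnit_pos)
open Neg

/-! ## §1 The frame-change numbers at `b0T` -/

section Values

variable (κ : Consts) {V : Type} [DecidableEq V] [Countable V] {G : SimpleGraph V} [G.LocallyFinite] (Φ : PlanarSkeletonNeg G) (t : V)
  (p : unitInterval) (D : DataN V) (g f : ℕ)

/-- **`aWT := ⌈D·(c₁·n·(b0T₀+1) + c₀·|v_α|·(b0T₁+1)) / (c₀c₁·A·Δ)⌉`** (floor + 1). [this work] -/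
def aWT : ℤ :=
  (prF κ Φ t p D g f).D * ((prF κ Φ t p D g f).c₁ * (prF κ Φ t p D g f).n * ((b0T κ Φ t p D g f 0 : ℤ) + 1) +
      (prF κ Φ t p D g f).c₀ * |(prF κ Φ t p D g f).vα| * ((b0T κ Φ t p D g f 1 : ℤ) + 1)) /
    ((prF κ Φ t p D g f).c₀ * (prF κ Φ t p D g f).c₁ * (prF κ Φ t p D g f).A *
      modulus (prF κ Φ t p D g f).n (prF κ Φ t p D g f).h (prF κ Φ t p D g f).vα (prF κ Φ t p D g f).vβ) + 1

/-- **`BxT := ⌈D·(b0T₁+1) / (c₁·A)⌉`** (floor + 1). [this work] -/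
def BxT : ℤ := (prF κ Φ t p D g f).D * ((b0T κ Φ t p D g f 1 : ℤ) + 1) / ((prF κ Φ t p D g f).c₁ * (prF κ Φ t p D g f).A) + 1

/-- **`bLT := BxT / U + 1`** (`U = n_L + |h_L|`). [this work] -/
def bLT : ℤ := BxT κ Φ t p D g f / (shearUnit (nL κ Φ t p D g f) (hL κ Φ t p D g f) : ℤ) + 1

/-- **`ha`** at `K := b0T`, `a := aWT`. [folklore] -/
theorem ha_T (hN : EqNumL κ Φ t p D g f) :
    (prF κ Φ t p D g f).D * ((prF κ Φ t p D g f).c₁ * ((prF κ Φ t p D g f).n : ℤ) * ((b0T κ Φ t p D g f 0 : ℤ) + 1) +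
        (prF κ Φ t p D g f).c₀ * |(prF κ Φ t p D g f).vα| * ((b0T κ Φ t p D g f 1 : ℤ) + 1)) ≤
      (prF κ Φ t p D g f).c₀ * (prF κ Φ t p D g f).c₁ * (prF κ Φ t p D g f).A *
        modulus (prF κ Φ t p D g f).n (prF κ Φ t p D g f).h (prF κ Φ t p D g f).vα (prF κ Φ t p D g f).vβ * aWT κ Φ t p D g f := by
  obtain ⟨hA, -, hm, hc₀, hc₁, -⟩ := prF_pos κ Φ t p D g f hN
  unfold aWT
  exact ceil_mul_le (by positivity)

/-- **`hBx`** at `b0T`: `D·(b0T₁+1) ≤ c₁·A·BxT`. [folklore] -/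
theorem hBx_T (hN : EqNumL κ Φ t p D g f) :
    (prF κ Φ t p D g f).D * ((b0T κ Φ t p D g f 1 : ℤ) + 1) ≤ (prF κ Φ t p D g f).c₁ * (prF κ Φ t p D g f).A * BxT κ Φ t p D g f := by
  obtain ⟨hA, -, -, -, hc₁, -⟩ := prF_pos κ Φ t p D g f hN
  unfold BxT
  exact ceil_mul_le (by positivity)

/-- **`hb`** at `b0T`: `BxT / U + 1 ≤ bLT` (by `rfl`). [folklore] -/
theorem hb_T : BxT κ Φ t p D g f / (shearUnit (nL κ Φ t p D g f) (hL κ Φ t p D g f) : ℤ) + 1 ≤ bLT κ Φ t p D g f := le_rfl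

/-- `0 ≤ aWT`, `0 ≤ BxT`, `1 ≤ bLT`. [folklore] -/
theorem aWT_nonneg (hN : EqNumL κ Φ t p D g f) : 0 ≤ aWT κ Φ t p D g f ∧ 0 ≤ BxT κ Φ t p D g f ∧ 1 ≤ bLT κ Φ t p D g f := by
  obtain ⟨hA, hn, hm, hc₀, hc₁, hD⟩ := prF_pos κ Φ t p D g f hN
  have h0 : 0 ≤ aWT κ Φ t p D g f := by
    unfold aWT
    have : 0 ≤ (prF κ Φ t p D g f).D * ((prF κ Φ t p D g f).c₁ * (prF κ Φ t p D g f).n * ((b0T κ Φ t p D g f 0 : ℤ) + 1) +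
        (prF κ Φ t p D g f).c₀ * |(prF κ Φ t p D g f).vα| * ((b0T κ Φ t p D g f 1 : ℤ) + 1)) /
        ((prF κ Φ t p D g f).c₀ * (prF κ Φ t p D g f).c₁ * (prF κ Φ t p D g f).A *
          modulus (prF κ Φ t p D g f).n (prF κ Φ t p D g f).h (prF κ Φ t p D g f).vα (prF κ Φ t p D g f).vβ) :=
      Int.ediv_nonneg (by positivity) (by positivity)
    linarith
  have h1 : 0 ≤ BxT κ Φ t p D g f := by
    unfold BxT
    have : 0 ≤ (prF κ Φ t p D g f).D * ((b0T κ Φ t p D g f 1 : ℤ) + 1) / ((prF κ Φ t p D g f).c₁ * (prF κ Φ t p D g f).A) :=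
      Int.ediv_nonneg (by positivity) (by positivity)
    linarith
  refine ⟨h0, h1, ?_⟩
  unfold bLT
  have hU := shearUnit_pos (one_le_of_eqNumL κ Φ t p D g f hN).1 (hL κ Φ t p D g f)
  have : 0 ≤ BxT κ Φ t p D g f / (shearUnit (nL κ Φ t p D g f) (hL κ Φ t p D g f) : ℤ) := Int.ediv_nonneg h1 hU.le
  linarith

/-- **(P5)** `r_i ≤ 4·b0T_i` (indeed `=`: `r = 40Kq·s`, `b0T = 10Kq·s`) and `hbr`: `b0T_i ≤ 2r_i`. [folklore] -/
theorem r_le_four_b0T (i : Fin 2) : (fcells κ Φ t p D g f).r i ≤ 4 * b0T κ Φ t p D g f i ∧ b0T κ Φ t p D g f i ≤ 2 * (fcells κ Φ t p D g f).r i := by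
  have hr := (fcells_K κ Φ t p D g f).2.2 i
  rw [b0T_eq, hr, Neg.K_eq]
  constructor <;> nlinarith [Nat.zero_le (Neg.Kq κ * (fcells κ Φ t p D g f).s i)]

/-- **`hsc0/hsc1`** (commensurability): `c_i′·A·(40·Δ) = r_i·D` (`c_i′ = 20K·s_i = 20r_i`, `A = 800`, `D = 800²·Δ`). [folklore] -/
theorem hsc_R (i : Fin 2) :
    20 * ((fcells κ Φ t p D g f).K : ℤ) * (((fcells κ Φ t p D g f).s i : ℕ) : ℤ) * 800 *
        (40 * modulus (nL κ Φ t p D g f) (hL κ Φ t p D g f) (vL κ Φ t p D g f) (vβL κ Φ t p D g f)) =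
      ((fcells κ Φ t p D g f).r i : ℤ) * Skelφ.NegPrm.Dof (nL κ Φ t p D g f) (hL κ Φ t p D g f) (ℓL κ Φ t p D g f) (vL κ Φ t p D g f) := by
  rw [Dof_eq_sq_mul, (fcells_K κ Φ t p D g f).2.2 i, (fcells_K κ Φ t p D g f).1]; push_cast; ring

/-! ## §2 The sizes (P3), (P4) -/

/-- **(P3)** `aWT ≤ 24·n_L` (under the numeric long clause: `|v_L| ≤ n_L`). [folklore] -/
theorem aWT_le (hN : EqNumL κ Φ t p D g f) : aWT κ Φ t p D g f ≤ 24 * (nL κ Φ t p D g f : ℤ) := by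
  obtain ⟨hA, hn, hm, hc₀, hc₁, hD⟩ := prF_pos κ Φ t p D g f hN
  obtain ⟨hA', hn', -, hvα, -, hc0, hc1, -⟩ := prF_fields κ Φ t p D g f
  have hv : |vL κ Φ t p D g f| ≤ nL κ Φ t p D g f := hN.v_le
  have hK : ((fcells κ Φ t p D g f).K : ℤ) = 40 * (Neg.Kq κ : ℤ) := by rw [(fcells_K κ Φ t p D g f).1, Neg.K_eq]; push_cast; ring
  set pr := prF κ Φ t p D g f
  set M := modulus pr.n pr.h pr.vα pr.vβ
  have hDM : pr.D = 800 ^ 2 * M := by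
    show pr.D = 800 ^ 2 * modulus pr.n pr.h pr.vα pr.vβ
    rw [prF_D]; unfold TwoAxis.Para.detD; rw [hA']
  set u0 := (Neg.Kq κ : ℤ) * (((fcells κ Φ t p D g f).s 0 : ℕ) : ℤ) with hu0
  set u1 := (Neg.Kq κ : ℤ) * (((fcells κ Φ t p D g f).s 1 : ℕ) : ℤ) with hu1
  have hq : (1 : ℤ) ≤ Neg.Kq κ := by exact_mod_cast Neg.one_le_Kq κ
  have hs0 : (1 : ℤ) ≤ (((fcells κ Φ t p D g f).s 0 : ℕ) : ℤ) := by exact_mod_cast (fcells κ Φ t p D g f).hs 0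
  have hs1 : (1 : ℤ) ≤ (((fcells κ Φ t p D g f).s 1 : ℕ) : ℤ) := by exact_mod_cast (fcells κ Φ t p D g f).hs 1
  have hu0' : 1 ≤ u0 := by rw [hu0]; nlinarith
  have hu1' : 1 ≤ u1 := by rw [hu1]; nlinarith
  have hb0 : (b0T κ Φ t p D g f 0 : ℤ) = 10 * u0 := by rw [hu0, b0T_eq]; push_cast; ring
  have hb1 : (b0T κ Φ t p D g f 1 : ℤ) = 10 * u1 := by rw [hu1, b0T_eq]; push_cast; ring
  have ec0 : pr.c₀ = 800 * u0 := by rw [hc0, hK, hu0]; ring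
  have ec1 : pr.c₁ = 800 * u1 := by rw [hc1, hK, hu1]; ring
  unfold aWT
  have en : pr.D * (pr.c₁ * pr.n * ((b0T κ Φ t p D g f 0 : ℤ) + 1) + pr.c₀ * |pr.vα| * ((b0T κ Φ t p D g f 1 : ℤ) + 1)) =
      (u1 * pr.n * (10 * u0 + 1) + u0 * |pr.vα| * (10 * u1 + 1)) * (800 ^ 2 * M * 800) := by
    rw [hDM, ec0, ec1, hb0, hb1]; ring
  have ed : pr.c₀ * pr.c₁ * pr.A * M = (u0 * u1) * (800 ^ 2 * M * 800) := by rw [ec0, ec1, hA']; ring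
  rw [en, ed, Int.mul_ediv_mul_of_pos_left _ _ (by positivity : (0 : ℤ) < 800 ^ 2 * M * 800)]
  -- `(u1 n (10u0+1) + u0 |vα| (10u1+1)) / (u0 u1) ≤ 11 n + 11 |vα| ≤ 22 n`
  have hX : u1 * pr.n * (10 * u0 + 1) + u0 * |pr.vα| * (10 * u1 + 1) ≤ (11 * pr.n + 11 * |pr.vα|) * (u0 * u1) := by
    have h1 : 0 ≤ pr.n := by linarith
    have h2 : 0 ≤ |pr.vα| := abs_nonneg _
    nlinarith [mul_nonneg h1 (by linarith : (0:ℤ) ≤ u1), mul_nonneg h2 (by linarith : (0:ℤ) ≤ u0),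
      mul_nonneg (mul_nonneg h1 (by linarith : (0:ℤ) ≤ u1)) (by linarith : (0:ℤ) ≤ u0 - 1),
      mul_nonneg (mul_nonneg h2 (by linarith : (0:ℤ) ≤ u0)) (by linarith : (0:ℤ) ≤ u1 - 1)]
  have hdiv := Int.ediv_le_of_le_mul (by positivity : 0 < u0 * u1) hX
  have hv' : |pr.vα| ≤ pr.n := by rw [hvα, hn']; exact hv
  rw [← hn']
  linarith

/-- **(P4)** `U·(bLT + 1) ≤ 12·Δ` (`Bx ≤ 11Δ + 1`, `U(Bx/U + 2) ≤ Bx + 2U`, `2U + 1 ≤ Δ`). [folklore] -/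
theorem U_bLT_le (hN : EqNumL κ Φ t p D g f) (hκ : (hL κ Φ t p D g f).natAbs ≤ 10 * nL κ Φ t p D g f) (hℓ : 24 ≤ ℓL κ Φ t p D g f) :
    (shearUnit (nL κ Φ t p D g f) (hL κ Φ t p D g f) : ℤ) * (bLT κ Φ t p D g f + 1) ≤
      12 * modulus (nL κ Φ t p D g f) (hL κ Φ t p D g f) (vL κ Φ t p D g f) (vβL κ Φ t p D g f) := by
  obtain ⟨hA, hn, hm, hc₀, hc₁, hD⟩ := prF_pos κ Φ t p D g f hN
  obtain ⟨hA', hn', hh', hvα, hvβ, hc0, hc1, -⟩ := prF_fields κ Φ t p D g f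
  obtain ⟨hn1, hℓ1⟩ := one_le_of_eqNumL κ Φ t p D g f hN
  have hU := shearUnit_pos hn1 (hL κ Φ t p D g f)
  have hK : ((fcells κ Φ t p D g f).K : ℤ) = 40 * (Neg.Kq κ : ℤ) := by rw [(fcells_K κ Φ t p D g f).1, Neg.K_eq]; push_cast; ring
  set pr := prF κ Φ t p D g f
  set M := modulus (nL κ Φ t p D g f) (hL κ Φ t p D g f) (vL κ Φ t p D g f) (vβL κ Φ t p D g f)
  have hM' : modulus pr.n pr.h pr.vα pr.vβ = M := by rw [hn', hh', hvα, hvβ]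
  have hMpos : 0 < M := by rw [← hM']; exact hm
  have hDM : pr.D = 800 ^ 2 * M := by rw [prF_D]; unfold TwoAxis.Para.detD; rw [hA', hM']
  set u1 := (Neg.Kq κ : ℤ) * (((fcells κ Φ t p D g f).s 1 : ℕ) : ℤ) with hu1
  have hq : (1 : ℤ) ≤ Neg.Kq κ := by exact_mod_cast Neg.one_le_Kq κ
  have hs1 : (1 : ℤ) ≤ (((fcells κ Φ t p D g f).s 1 : ℕ) : ℤ) := by exact_mod_cast (fcells κ Φ t p D g f).hs 1
  have hu1' : 1 ≤ u1 := by rw [hu1]; nlinarith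
  have hb1 : (b0T κ Φ t p D g f 1 : ℤ) = 10 * u1 := by rw [hu1, b0T_eq]; push_cast; ring
  have ec1 : pr.c₁ = 800 * u1 := by rw [hc1, hK, hu1]; ring
  -- `BxT = ⌊M(10u1+1)/u1⌋ + 1 ≤ 11M + 1`
  have hBx : BxT κ Φ t p D g f ≤ 11 * M + 1 := by
    unfold BxT
    rw [hDM, ec1, hA', hb1, show 800 ^ 2 * M * (10 * u1 + 1) = (M * (10 * u1 + 1)) * (800 * 800) by ring,
      show 800 * u1 * 800 = u1 * (800 * 800) by ring, Int.mul_ediv_mul_of_pos_left _ _ (by norm_num : (0:ℤ) < 800 * 800)]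
    have hX : M * (10 * u1 + 1) ≤ (11 * M) * u1 := by nlinarith
    have := Int.ediv_le_of_le_mul (by linarith : 0 < u1) hX
    linarith
  -- `U·(bLT + 1) = U·(BxT/U + 2) ≤ BxT + 2U`
  have h1 : (shearUnit (nL κ Φ t p D g f) (hL κ Φ t p D g f) : ℤ) * (BxT κ Φ t p D g f / (shearUnit (nL κ Φ t p D g f) (hL κ Φ t p D g f) : ℤ)) ≤
      BxT κ Φ t p D g f := Int.mul_ediv_self_le hU.ne'
  have e : (shearUnit (nL κ Φ t p D g f) (hL κ Φ t p D g f) : ℤ) * (bLT κ Φ t p D g f + 1) =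
      (shearUnit (nL κ Φ t p D g f) (hL κ Φ t p D g f) : ℤ) * (BxT κ Φ t p D g f / (shearUnit (nL κ Φ t p D g f) (hL κ Φ t p D g f) : ℤ)) +
        2 * (shearUnit (nL κ Φ t p D g f) (hL κ Φ t p D g f) : ℤ) := by unfold bLT; ring
  rw [e]
  -- `2U + 1 ≤ M`: `U ≤ 11 n`, `M > n(ℓ−1) ≥ 23 n`
  have hUle : (shearUnit (nL κ Φ t p D g f) (hL κ Φ t p D g f) : ℤ) ≤ 11 * (nL κ Φ t p D g f : ℤ) := by
    unfold Skelφ.shearUnit; push_cast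
    have : ((hL κ Φ t p D g f).natAbs : ℤ) ≤ 10 * (nL κ Φ t p D g f : ℤ) := by exact_mod_cast hκ
    linarith
  have hmlo := (Skelφ.NegPrm.modulus_vβOf hn1 (hL κ Φ t p D g f) (ℓL κ Φ t p D g f) (vL κ Φ t p D g f)).1
  have eβ : vβL κ Φ t p D g f = Skelφ.NegPrm.vβOf (nL κ Φ t p D g f) (hL κ Φ t p D g f) (ℓL κ Φ t p D g f) (vL κ Φ t p D g f) := rfl
  rw [← eβ] at hmlo
  have hℓ' : (24 : ℤ) ≤ ℓL κ Φ t p D g f := by exact_mod_cast hℓ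
  have hn0 : (0 : ℤ) ≤ nL κ Φ t p D g f := by positivity
  have h23 : 23 * (nL κ Φ t p D g f : ℤ) ≤ M := by nlinarith
  linarith

end Values

end NegB

end PlanarSkeletonNeg

end Summit.CriticalPhenomena.PercolationContinuityZ3.Theorems.Transplant
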